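import Summits.CriticalPhenomena.PercolationContinuityZ3.Theorems.TallClusterMassBound.Negative.MassExponentFamily
import Summits.CriticalPhenomena.PercolationContinuityZ3.Theorems.PercLowPointHalfSpaceQuantitativeBGNKlTransfer
import Literature.Probability.Percolation.HutchcroftVolumeTail
import Literature.Probability.Percolation.SusceptibilityGammaOne
import Literature.Probability.Percolation.CriticalContinuityProofs

/-!
# Crux `PercLowPointHalfSpace.TallClusterMassBound` (stmt-CriticalPhenomena-0912), line `SketchIdeator4`
# — stub `stub_klVolumeTail` (ARROW 3, an ENGINE)

Helper file for the checked skeleton `work/TallClusterMassBound.lean` of the line (STUB 4 there); proves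
exactly the registered stub signature `stub_klVolumeTail`; lands with `--supports stmt-CriticalPhenomena-0912`.

## Statement

A subcritical susceptibility bound `χ(p) ≤ C (p_c - p)^{-γ}` for all `p < p_c = p_c(ℤ³)` gives the
critical volume tail `P_{p_c}(|C(0)| ≥ n) ≤ C' n^{-(1 - γ/2)}` for every `n ≥ 1`.

## The argument (Hutchcroft 2022, arXiv:2106.06400, Thm. 1.3 + Markov, at the scale `ε = ε₀ n^{-1/2}`)

* `klVolumeTail_real_clusterSizeGe_le`: the tree's Dewan–Muirhead/Hutchcroft KL lemma
  `ClusterExploration.real_clusterSizeGe_le_of_kl` on `G = ℤ³` (`Δ = 6`, `degree_zdGraph_le`) at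
  `(p, q)`, followed by Markov `n · P_p(|C| ≥ n) ≤ Σ_{j ≤ n} P_p(|C| ≥ j) ≤ E_p|C| ≤ M`
  (`klSurfaceTail_mul_real_clusterSizeGe_le_sum`, `ofReal_sum_real_clusterSizeGe_le`):
  `P_q(|C(0)| ≥ n) ≤ M (2/n + 48 kl(p‖q))`.
* `stub_klVolumeTail`: take `q = p_c` (`0 < p_c(ℤ³) < 1`, `criticalProb_zd_pos` / `criticalProb_zd_lt_one`),
  `p = p_c - ε` with `ε = ε₀ n^{-1/2}`, `ε₀ = p_c/2`, `M = C ε^{-γ}` (`E_p|C| = χ(p)` below `p_c`,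
  `expClusterSize_eq_ofReal_chi`; `M ≥ χ(p) ≥ 1`, `one_le_chi`), and the chi-square bound
  `kl(p_c - ε ‖ p_c) ≤ ε²/(p_c(1-p_c))` (`QuantitativeBGNKlTransfer.binaryKL_le_sq_div`):
  `P_{p_c}(|C| ≥ n) ≤ C ε^{-γ} (2/n + 48 ε²/(p_c(1-p_c)))`
  `= C ε₀^{-γ} (2 + 48 ε₀²/(p_c(1-p_c))) · n^{-(1-γ/2)}`.

The hypotheses `1 ≤ γ`, `γ < 2` of the registered signature are not used. No new definitions.
-/

noncomputable section

open MeasureTheory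
open Literature.Probability.Percolation Literature.Probability.LatticeModels Literature.Probability.Entropy
open Summit.CriticalPhenomena.PercolationContinuityZ3.Theorems.TallClusterMassBound.Negative
open scoped ENNReal

namespace Summit.CriticalPhenomena.PercolationContinuityZ3.Theorems.TallClusterMassBound.TightnessLine

/-- **KL + Markov on `ℤ³`** (Hutchcroft 2022, Thm. 1.3 with `Δ = 6`, then Markov with the KL price paid in
the mean cluster size): for `p, q ∈ (0,1)`, any real `M ≥ 0` with `E_p|C(0)| ≤ M`, and `n ≥ 1`,
`P_q(|C(0)| ≥ n) ≤ M · (2/n + 48 · kl(p‖q))`. [cite: Hutchcroft2022Triangle, Thm. 1.3] -/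
theorem klVolumeTail_real_clusterSizeGe_le (p q : unitInterval) (hp0 : 0 < (p : ℝ)) (hp1 : (p : ℝ) < 1)
    (hq0 : 0 < (q : ℝ)) (hq1 : (q : ℝ) < 1) {M : ℝ} (hM : 0 ≤ M)
    (hχ : expClusterSize (zdGraph 3) (0 : V3) p ≤ ENNReal.ofReal M) {n : ℕ} (hn : 1 ≤ n) :
    (Pp q).real (clusterSizeGe (0 : V3) n) ≤ M * (2 / (n : ℝ) + 48 * binaryKL (p : ℝ) (q : ℝ)) := by
  -- `Δ = 6 = 2 · 3` on `ℤ³`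
  have hΔ : ∀ v : V3, (zdGraph 3).degree v ≤ 6 := fun v => degree_zdGraph_le v
  -- Hutchcroft's Thm. 1.3 on `ℤ³`
  have h := ClusterExploration.real_clusterSizeGe_le_of_kl (G := zdGraph 3) (n := n) hΔ (0 : V3) p q
    hp0 hp1 hq0 hq1
  -- the truncated mean `S_n ≤ M`
  set S : ℝ := ∑ j ∈ Finset.Icc 1 n, (bondPercolation (zdGraph 3) p).real (clusterSizeGe (0 : V3) j)
    with hS
  have hSM : S ≤ M :=
    (ENNReal.ofReal_le_ofReal_iff hM).1
      ((ofReal_sum_real_clusterSizeGe_le (zdGraph 3) (0 : V3) p n).trans hχ)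
  -- Markov: `n · P_p(|C| ≥ n) ≤ S_n ≤ M`
  have hn0 : (0 : ℝ) < n := by exact_mod_cast hn
  have ha : (bondPercolation (zdGraph 3) p).real (clusterSizeGe (0 : V3) n) ≤ M / n := by
    rw [le_div_iff₀ hn0, mul_comm]
    exact (klSurfaceTail_mul_real_clusterSizeGe_le_sum (zdGraph 3) (0 : V3) p n).trans hSM
  -- `kl ≥ 0`
  have hkl : 0 ≤ binaryKL (p : ℝ) (q : ℝ) := binaryKL_nonneg hp0.le hp1.le hq0 hq1
  change (bondPercolation (zdGraph 3) q).real (clusterSizeGe (0 : V3) n) ≤ _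
  calc (bondPercolation (zdGraph 3) q).real (clusterSizeGe (0 : V3) n)
      ≤ 2 * (bondPercolation (zdGraph 3) p).real (clusterSizeGe (0 : V3) n) +
          8 * ((6 : ℕ) : ℝ) * binaryKL (p : ℝ) (q : ℝ) * S := h
    _ ≤ 2 * (M / n) + 8 * ((6 : ℕ) : ℝ) * binaryKL (p : ℝ) (q : ℝ) * M :=
        add_le_add (mul_le_mul_of_nonneg_left ha (by norm_num))
          (mul_le_mul_of_nonneg_left hSM (by positivity))
    _ = M * (2 / (n : ℝ) + 48 * binaryKL (p : ℝ) (q : ℝ)) := by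
        push_cast
        ring

/-- **STUB `stub_klVolumeTail`** (ARROW 3 of line `SketchIdeator4`, crux `TallClusterMassBound`): a subcritical
susceptibility bound `χ(p) ≤ C (p_c - p)^{-γ}` for all `p < p_c(ℤ³)` gives the critical volume tail
`P_{p_c}(|C(0)| ≥ n) ≤ C' n^{-(1 - γ/2)}` (`n ≥ 1`), with `C' = C ε₀^{-γ} (2 + 48 ε₀²/(p_c(1-p_c)))`,
`ε₀ = p_c/2`: the KL lemma at `(p_c - ε₀ n^{-1/2}, p_c)` with `M = C ε^{-γ}` and
`kl(p_c - ε ‖ p_c) ≤ ε²/(p_c(1-p_c))`. The hypotheses `1 ≤ γ < 2` are not needed.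
[cite: Hutchcroft2022Triangle, Thm. 1.3] -/
theorem stub_klVolumeTail :
    ∀ (γ C : ℝ), 1 ≤ γ → γ < 2 →
      (∀ p : unitInterval, (p : ℝ) < criticalProb (zdGraph 3) (0 : V3) →
        chi 3 p ≤ C * (criticalProb (zdGraph 3) (0 : V3) - (p : ℝ)) ^ (-γ)) →
      ∃ C' : ℝ, ∀ n : ℕ, 1 ≤ n →
        (Pp (criticalProbI 3)).real (clusterSizeGe (0 : V3) n) ≤ C' * (n : ℝ) ^ (-(1 - γ / 2)) := by
  intro γ C _hγ1 _hγ2 hS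
  set pc : ℝ := criticalProb (zdGraph 3) (0 : V3) with hpc_def
  have hpc0 : 0 < pc := criticalProb_zd_pos 3 (by norm_num)
  have hpc1 : pc < 1 := criticalProb_zd_lt_one (d := 3) (by norm_num)
  -- the scale-free part `ε₀` of `ε = ε₀ n^{-1/2}`
  set ε₀ : ℝ := pc / 2 with hε₀_def
  have hε₀pos : 0 < ε₀ := by rw [hε₀_def]; linarith
  refine ⟨C * ε₀ ^ (-γ) * (2 + 48 * (ε₀ ^ 2 / (pc * (1 - pc)))), fun n hn => ?_⟩
  have hn0 : (0 : ℝ) < n := by exact_mod_cast hn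
  have hn1 : (1 : ℝ) ≤ n := by exact_mod_cast hn
  -- the scale `s = n^{-1/2} ∈ (0, 1]`
  set s : ℝ := (n : ℝ) ^ (-(1 / 2 : ℝ)) with hs_def
  have hs0 : 0 < s := Real.rpow_pos_of_pos hn0 _
  have hs1 : s ≤ 1 := Real.rpow_le_one_of_one_le_of_nonpos hn1 (by norm_num)
  have hs2 : s ^ 2 = (n : ℝ)⁻¹ := by
    rw [hs_def, ← Real.rpow_natCast ((n : ℝ) ^ (-(1 / 2 : ℝ))) 2, ← Real.rpow_mul hn0.le,
      ← Real.rpow_neg_one]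
    congr 1
    norm_num
  have e2 : s ^ (-γ) * s ^ 2 = (n : ℝ) ^ (-(1 - γ / 2)) := by
    rw [hs_def, ← Real.rpow_mul hn0.le, ← Real.rpow_natCast ((n : ℝ) ^ (-(1 / 2 : ℝ))) 2,
      ← Real.rpow_mul hn0.le, ← Real.rpow_add hn0]
    congr 1
    push_cast
    ring
  -- `ε = ε₀ s` and the subcritical parameter `p = p_c - ε`
  set ε : ℝ := ε₀ * s with hε_def
  have hε0 : 0 < ε := mul_pos hε₀pos hs0
  have hεle : ε ≤ ε₀ := by rw [hε_def]; exact mul_le_of_le_one_right hε₀pos.le hs1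
  have hp0 : 0 < pc - ε := by linarith
  have hp1 : pc - ε < 1 := by linarith
  set p : unitInterval := ⟨pc - ε, hp0.le, hp1.le⟩ with hp_def
  have hpcoe : (p : ℝ) = pc - ε := rfl
  have hplt : (p : ℝ) < pc := by rw [hpcoe]; linarith
  -- the susceptibility hypothesis at `p`: `χ(p) ≤ C ε^{-γ}`, and `χ(p) ≥ 1`
  have hSp := hS p hplt
  have hpe : pc - (p : ℝ) = ε := by rw [hpcoe]; ring
  rw [hpe] at hSp
  have hχ1 : 1 ≤ chi 3 p := one_le_chi (d := 3) (by norm_num) p hplt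
  have hM0 : 0 ≤ C * ε ^ (-γ) := by linarith
  -- `E_p|C(0)| = χ(p) ≤ M`
  have hχ : expClusterSize (zdGraph 3) (0 : V3) p ≤ ENNReal.ofReal (C * ε ^ (-γ)) := by
    rw [expClusterSize_eq_ofReal_chi (d := 3) (by norm_num) p hplt]
    exact ENNReal.ofReal_le_ofReal hSp
  -- the KL lemma at `(p, p_c)` with `M = C ε^{-γ}`
  have hq0 : 0 < ((criticalProbI 3 : unitInterval) : ℝ) := hpc0
  have hq1 : ((criticalProbI 3 : unitInterval) : ℝ) < 1 := hpc1
  have hK2 := klVolumeTail_real_clusterSizeGe_le p (criticalProbI 3) (by rw [hpcoe]; exact hp0)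
    (by rw [hpcoe]; exact hp1) hq0 hq1 hM0 hχ hn
  -- the chi-square bound on the KL price: `kl(p ‖ p_c) ≤ ε² / (p_c (1 - p_c))`
  have hkl : binaryKL (p : ℝ) ((criticalProbI 3 : unitInterval) : ℝ) ≤ ε ^ 2 / (pc * (1 - pc)) := by
    have h := QuantitativeBGNKlTransfer.binaryKL_le_sq_div (a := pc - ε) (b := pc) hp0.le hp1.le
      hpc0 hpc1
    have e : (pc - ε - pc) ^ 2 = ε ^ 2 := by ring
    rw [e] at h
    exact h
  -- assemble
  calc (Pp (criticalProbI 3)).real (clusterSizeGe (0 : V3) n)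
      ≤ C * ε ^ (-γ) * (2 / (n : ℝ) + 48 * binaryKL (p : ℝ) ((criticalProbI 3 : unitInterval) : ℝ)) :=
        hK2
    _ ≤ C * ε ^ (-γ) * (2 / (n : ℝ) + 48 * (ε ^ 2 / (pc * (1 - pc)))) :=
        mul_le_mul_of_nonneg_left
          (add_le_add le_rfl (mul_le_mul_of_nonneg_left hkl (by norm_num : (0 : ℝ) ≤ 48))) hM0
    _ = C * ε₀ ^ (-γ) * (2 + 48 * (ε₀ ^ 2 / (pc * (1 - pc)))) * (n : ℝ) ^ (-(1 - γ / 2)) := by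
        rw [← e2, hε_def, Real.mul_rpow hε₀pos.le hs0.le, div_eq_mul_inv (2 : ℝ) (n : ℝ), ← hs2]
        ring

end Summit.CriticalPhenomena.PercolationContinuityZ3.Theorems.TallClusterMassBound.TightnessLine

end
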